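import Summits.QuantumFields.BalabanUV.Beta.KernelWardHColumn
import Summits.QuantumFields.BalabanUV.Beta.BorderedHessianStepStraight

/-!
# `BalabanUV.Beta.KernelWardHColumnStep` — binder row D1, the WARD binder `hW`, leaf (W-LH)ⱼ₊₁ (generic part): THE ℋ-COLUMN WARD LAW AT
# STEPS `j + 1` from rule AME against the straight STEP candidate `bhKStep d Lc (j+1)`, constant `cH (j+1) = (stepScale·Lc^{d+1})⁻¹` DERIVED

HONEST FRAMING (cell contract, verbatim): «discharging `BetaPertH` makes Bałaban's UV stability UNCONDITIONAL — a real constructive-QFT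
result; it is NOT the continuum limit and NOT the Clay problem.»  DERIVED cell leaf (pub-balaban β sub-cell, D1 formalisation swarm, seat
`b2b-balaban-beta-d1-formalise-leaf-07`; leaf (W-LH)_{j ≥ 1} of an1-g25's `HOME/b2b-balaban-beta-an1-g25/SKELETON-D1-hW.v1.md` §2, GENERIC HALF:
the relative-inverse input `RelInv G_{j+1} (bhKStep d Lc (j+1)) (axEc ρ Lc)` stays a HYPOTHESIS here — it is an2-g15's
`RelInvBorderedHessianStep.relInv_coDressKBmAt_KInvStep_succ_bhKStep`, certified (7-file certificate 23e3dac0b5390747) but not yet landed).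
No statement of Bałaban's papers is typed here, no `[cite:]` tag, no `def`, no `Prop` fact; it instantiates no binder of the β-function wall.
NOT `BetaPertH`; NOT continuum; NOT Clay.  HONEST DEPENDENCY (verbatim): continuum YM on T⁴ ⇐ BetaPertH ∧ nine spine estimates (0/9 proved);
BetaPertH ⇐ (D1) ∧ (D4) ∧ CAP+tail; G-an2-4 gates asym, D1 and NE2/3/4.

## What is here ([folklore]; «not in print; our proof attempt»)

`KernelWardHColumn.colH_ward_of_AME` run one level up: the bordered operator is now the straight STEP candidate
`bhKStep d Lc (j+1) = [[wVH·E2, stepScale·(−𝒬ᵀ_{Lc})],[stepScale·𝒬_{Lc}, 0]]` (`BorderedHessianStepStraight`, p206693).  With the same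
pure-gauge test kernel `T_y` (one column `(dz 1_{B(y)} ; 0)`):
* the VALUE-HESSIAN rows kill the pure gauge — `Σ'_y′ Σ_l wΦ κ l (t − y′)·(dz 1_B)_l(y′) = ⟨codiff₁ wΦ(κ, ·, t − ·), 1_B⟩ = 0` by
  `KKTFluctuationEnergy.lip1_dz` and `ValueHessianBlind.codiff₁_wΦ_right` (this is an1's sub-leaf (W-LH-E2)ⱼ «`E2` kills pure gauges»,
  here a three-line consequence of an2's L1.a mechanism, not a new fact);
* the border rows give `stepScale·[t coarse]·Lc^{d+1}·(δ_{y−e_κ} − δ_y)(quo t)` (`comp_bhKStep_succ_inr`, `contourSum_dz`, `blockSum_blockInd`);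
so rule AME `(G ∘ bhKStep (j+1)) ∘ axEc ρ Lc = axEc ρ Lc` yields
**`colH_ward_of_AME_step : Σ_μ (colH G Lc μ (y − e_μ) κ′ u − colH G Lc μ y κ′ u) = (stepScale d Lc (j+1) · Lc^{d+1})⁻¹ · gaugeWt Lc y κ′ u`**
for every spread `G`, every offset `ρ`.  The INSTANCE `G_{j+1} := coDressKBmAt (toSite r) Lc (KInvStep Lc (j+1))` follows by one line from
an2's `relInv_coDressKBmAt_KInvStep_succ_bhKStep hr j |>.AME` once that module is in the tree (then `cH (j+1) = (stepScale·Lc^{d+1})⁻¹`,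
`cH 0 = Lc^{−(d+1)}` from `KernelWardHColumn.colH_ward_KInvStep_zero`).
v1.1 (APPEND-ONLY): §2 `colH_ward_of_AME_all` — both cases packaged as ONE constant family `cH j := (stepScale d N j · N^{d+1})⁻¹` over a
step family `Gs j` with rule AME against `bhKStep d N j` for every `j` (the exact shape of the root's `hH`, modulo the RelInv inputs).
All declarations `[folklore]`; axioms standard.  Provenance: b2b-balaban β sub-cell, D1 formalisation swarm leaf-07, 2026-08-20 (v1, v1.1); over
`KernelWardHColumn` (leaf-07), `BorderedHessianStepStraight` / `ValueHessianBlind` (an2 gen 15), `KKTFluctuationEnergy` (an5) BY NAME; no existing file touched.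
-/

open Finset Filter
open scoped BigOperators
open Literature.Probability.LatticeModels (TorusSite Torus.proj Torus.proj_apply)
open Literature.MathematicalPhysics.QuantumFieldTheory
open Literature.MathematicalPhysics.QuantumFieldTheory.Balaban1983to89
open Literature.MathematicalPhysics.QuantumFieldTheory.Balaban1983to89.Beta
open B12Sec2to5 (l1 l1_nonneg)
open ExpKernelCalculus (MKer Decays BiLoc comp)
open AffineAveraging (Form0 Form1 Form2 box toSite dz curv curvAdj contourSum blockSum curv_dz contourSum_dz)
open AffineReproduction (contourSumAdj)
open AveragingContours (blk blk_block off off_mem_box blk_add_off)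
open AveragingWardStencils (b6UnitVec_eq)
open LatticeForm (quo)
open KKTFluctuationEnergy (lip0 lip1 lip1_dz summable_mul_of_bdd')
open DecimatedMomentLimit (summable_of_decay510)
open KernelSpecInstance (wΦ decay_wΦ)
open OneStepResolventKernel (Fib KInv quo_zsmul proj_zsmul)
open OneStepKernelFamily (KInvStep colH)
open AxialProjector (zsmul_blk_le lt_zsmul_blk_add)
open ResolventComposition (tsum_sublattice₀)
open Summit.QuantumFields.BalabanUV.Beta.TameKernelCalculus
open Summit.QuantumFields.BalabanUV.Beta.ChartConjugationRelative (RelInv)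
open Summit.QuantumFields.BalabanUV.Beta.AxialDressingRooted (IsCombBondAt axEc comp_axEc_apply spr_axEc spr_comp coDressKBmAt
  one_le_of_neZero)
open Summit.QuantumFields.BalabanUV.Beta.BorderedHessian (bhK bhKStep spr_bhKStep stepScale stepScale_ne_zero fcol mcol fcol_apply mcol_apply
  comp_bhKStep_succ_inl comp_bhKStep_succ_inr exists_abs_wΦ_le codiff₁_wΦ_right)
open Summit.QuantumFields.BalabanUV.Beta.KernelWardRelative (gaugeWt)
open Summit.QuantumFields.BalabanUV.Beta.KernelWardHColumn (loc_of_bdd_support l1_sub_zsmul_le_of_blk blockSum_blockInd)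

namespace Summit.QuantumFields.BalabanUV.Beta.KernelWardHColumnStep

noncomputable section

variable {d : ℕ}

section Generic

variable {N : ℕ} [NeZero N] {ρ : Fin (d + 1) → ℤ} {G : MKer (d + 1) (Fib d)}

open Classical in
/-- [folklore] **THE ℋ-COLUMN WARD LAW AT STEP `j + 1` FROM RULE AME** against the straight step candidate: if `G` is spread and
`(G ∘ bhKStep d N (j+1)) ∘ axEc ρ N = axEc ρ N`, then for every coarse label `y` and fine leg `(u, κ′)`:
`Σ_μ (colH G N μ (y − e_μ) κ′ u − colH G N μ y κ′ u) = (stepScale d N (j+1) · N^{d+1})⁻¹ · gaugeWt N y κ′ u`. -/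
theorem colH_ward_of_AME_step (j : ℕ) (hG : Spr G) (hAME : comp (comp G (bhKStep d N (j + 1))) (axEc ρ N) = axEc ρ N)
    (y : Fin (d + 1) → ℤ) (κ' : Fin (d + 1)) (u : Fin (d + 1) → ℤ) :
    ∑ μ, (colH G N μ (y - B6BondElimination.unitVec μ) κ' u - colH G N μ y κ' u) =
      (stepScale d N (j + 1) * (N : ℝ) ^ (d + 1))⁻¹ * gaugeWt N y κ' u := by
  have hN : 1 ≤ N := one_le_of_neZero N
  have hN0 : ((N : ℝ) ^ (d + 1)) ≠ 0 := pow_ne_zero _ (by exact_mod_cast (NeZero.ne N))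
  -- the block indicator of coarse label `y` and the pure-gauge test kernel (single non-zero column `(0, inl 0)`)
  set bI : Form0 (d + 1) ℝ := fun v => if blk N v = y then 1 else 0 with hbI
  set T : MKer (d + 1) (Fib d) := fun z z' f b =>
    if z' = 0 ∧ b = Sum.inl 0 then (match f with | Sum.inl κ => bI (z + AffineAveraging.unitVec κ) - bI z | Sum.inr _ => 0) else 0 with hT
  have hT_inl : ∀ z z' κ b, T z z' (Sum.inl κ) b = if z' = 0 ∧ b = Sum.inl 0 then bI (z + AffineAveraging.unitVec κ) - bI z else 0 :=
    fun z z' κ b => rfl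
  have hT_inr : ∀ z z' m b, T z z' (Sum.inr m) b = 0 := by
    intro z z' m b; simp only [hT]; split_ifs <;> rfl
  have hbI_le : ∀ v, |bI v| ≤ 1 := by
    intro v; simp only [hbI]; split_ifs <;> simp
  have hT_le : ∀ z z' a b, |T z z' a b| ≤ 2 := by
    intro z z' a b
    rcases a with κ | m
    · rw [hT_inl z z' κ b]
      split_ifs
      · exact (abs_sub _ _).trans (by linarith [hbI_le (z + AffineAveraging.unitVec κ), hbI_le z])
      · norm_num
    · rw [hT_inr z z' m b, abs_zero]; norm_num
  -- (a) `T` is localised, hence tame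
  have hTloc : Loc T := by
    refine loc_of_bdd_support ((N : ℤ) • y) 0 (B := 2) (R := (d + 1 : ℝ) * N) hT_le (fun z z' a b hne => ?_)
    · rcases a with κ | m
      · rw [hT_inl z z' κ b] at hne
        by_cases hc : z' = 0 ∧ b = Sum.inl 0
        · rw [if_pos hc] at hne
          have hl0 : l1 (z' - 0 : Fin (d + 1) → ℤ) = 0 := by rw [hc.1]; simp [l1]
          rw [hl0, add_zero]
          have hor : blk N z = y ∨ blk N (z + AffineAveraging.unitVec κ) = y := by
            by_contra hno
            have hn1 : ¬ blk N z = y := fun h => hno (Or.inl h)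
            have hn2 : ¬ blk N (z + AffineAveraging.unitVec κ) = y := fun h => hno (Or.inr h)
            apply hne
            simp only [hbI, if_neg hn1, if_neg hn2, sub_self]
          exact l1_sub_zsmul_le_of_blk hN hor
        · rw [if_neg hc] at hne; exact absurd rfl hne
      · rw [hT_inr z z' m b] at hne; exact absurd rfl hne
  -- (b) `axEc` fixes `T`: a comb bond never crosses a block boundary; multiplier rows of `T` vanish
  have hET : comp (axEc ρ N) T = T := by
    funext z z' a b
    rw [comp_axEc_apply]
    rcases a with α | m
    · simp only
      split_ifs with hcomb
      · rw [hT_inl z z' α b]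
        split_ifs
        · simp only [hbI]
          rw [hcomb.2, sub_self]
        · rfl
      · rfl
    · simp only
      rw [hT_inr z z' m b]; split_ifs <;> rfl
  -- (c) the action of the straight bordered Hessian on `T`: column `(0, inl 0)`
  have hfcol : fcol T 0 (Sum.inl 0) = dz bI := by
    funext l v
    rw [fcol_apply, hT_inl v 0 l (Sum.inl 0), if_pos ⟨rfl, rfl⟩]
    rfl
  have hmcol : mcol N T 0 (Sum.inl 0) = 0 := by
    funext l v
    rw [mcol_apply, hT_inr ((N : ℤ) • v) 0 l (Sum.inl 0)]
    rfl
  -- `bI` is finitely supported (on the block of `y`), hence summable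
  have hbI_summable : Summable bI := by
    refine summable_of_ne_finset_zero (s := (box (d + 1) N).image fun b => (N : ℤ) • y + toSite b) fun v hv => ?_
    simp only [hbI]
    rw [if_neg]
    intro hvy
    apply hv
    refine Finset.mem_image.2 ⟨off N v, off_mem_box hN v, ?_⟩
    rw [← hvy]
    exact blk_add_off hN v
  -- the value-Hessian rows kill the pure gauge: `Σ' Σ_l wΦ κ l (t − ·) · (dz 1_B)_l = ⟨codiff₁ wΦ(κ,·,t−·), 1_B⟩ = 0`
  obtain ⟨Cw, hCw⟩ := exists_abs_wΦ_le (N := N ^ (j + 1)) (d := d)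
  obtain ⟨δ, C, hδ, hdec⟩ := decay_wΦ (N := N ^ (j + 1)) (d := d)
  have hX : ∀ (t : Fin (d + 1) → ℤ) (κ : Fin (d + 1)), Summable fun y' => ∑ l : Fin (d + 1),
      wΦ (N := N ^ (j + 1)) κ l (t - y') * T y' 0 (Sum.inl l) (Sum.inl 0) := fun t κ =>
    summable_sum fun l _ => summable_mul_of_bdd' (M := 2)
      ((summable_of_decay510 hδ (hdec κ l)).comp_injective sub_right_injective) (fun y' => hT_le y' 0 (Sum.inl l) (Sum.inl 0))
  have hkill : ∀ (t : Fin (d + 1) → ℤ) (κ : Fin (d + 1)),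
      (∑' y', ∑ l : Fin (d + 1), wΦ (N := N ^ (j + 1)) κ l (t - y') * T y' 0 (Sum.inl l) (Sum.inl 0)) = 0 := by
    intro t κ
    have e : (∑' y', ∑ l : Fin (d + 1), wΦ (N := N ^ (j + 1)) κ l (t - y') * T y' 0 (Sum.inl l) (Sum.inl 0)) =
        lip1 (fun l y' => wΦ (N := N ^ (j + 1)) κ l (t - y')) (dz bI) := by
      rw [← hfcol]; rfl
    rw [e, lip1_dz (M := Cw) (fun l y' => hCw κ l (t - y')) hbI_summable, codiff₁_wΦ_right]
    simp [lip0]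
  have hM_inl : ∀ t l, comp (bhKStep d N (j + 1)) T t 0 (Sum.inl l) (Sum.inl 0) = 0 := by
    intro t l
    rw [comp_bhKStep_succ_inl j T t 0 l (Sum.inl 0) (hX t l), hkill, hmcol]
    simp [contourSumAdj]
  have hM_inr : ∀ t m, comp (bhKStep d N (j + 1)) T t 0 (Sum.inr m) (Sum.inl 0) =
      stepScale d N (j + 1) * (if Torus.proj N t = 0 then
        ((if quo N t + AffineAveraging.unitVec m = y then (N : ℝ) ^ (d + 1) else 0) - (if quo N t = y then (N : ℝ) ^ (d + 1) else 0))
      else 0) := by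
    intro t m
    rw [comp_bhKStep_succ_inr, hfcol, contourSum_dz]
    by_cases ht : Torus.proj N t = 0
    · rw [if_pos ht, if_pos ht]
      simp only [dz]
      rw [hbI, blockSum_blockInd, blockSum_blockInd]
    · rw [if_neg ht, if_neg ht]
  -- (d) contract rule AME with `T` and reassociate
  have hM : Spr (bhKStep d N (j + 1)) := spr_bhKStep (j + 1)
  have hE : Spr (axEc ρ N) := spr_axEc _ _
  have h1 : comp (comp (comp G (bhKStep d N (j + 1))) (axEc ρ N)) T = T := by rw [hAME, hET]
  rw [← comp_assoc_tame (spr_comp hG hM).tame hE.tame hTloc.tame, hET, ← comp_assoc_tame hG.tame hM.tame hTloc.tame] at h1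
  -- (e) read the entry `(u, 0, inl κ′, inl 0)`
  have h2 := congrFun (congrFun (congrFun (congrFun h1 u) 0) (Sum.inl κ')) (Sum.inl 0)
  -- the right-hand side is the pure-gauge weight
  have hR : T u 0 (Sum.inl κ') (Sum.inl 0) = gaugeWt N y κ' u := by
    rw [hT_inl u 0 κ' (Sum.inl 0), if_pos ⟨rfl, rfl⟩]
    simp only [hbI, gaugeWt, b6UnitVec_eq]
  -- the left-hand side: only the coarse multiplier legs of `G` see the (non-zero part of the) image
  set c : (Fin (d + 1) → ℤ) → ℝ := fun q => if q = y then (N : ℝ) ^ (d + 1) else 0 with hc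
  have hL : comp G (comp (bhKStep d N (j + 1)) T) u 0 (Sum.inl κ') (Sum.inl 0) =
      ∑' q : Fin (d + 1) → ℤ, ∑ m : Fin (d + 1), G u ((N : ℤ) • q) (Sum.inl κ') (Sum.inr m) *
        (stepScale d N (j + 1) * (c (q + AffineAveraging.unitVec m) - c q)) := by
    show (∑' t, ∑ g : Fib d, G u t (Sum.inl κ') g * comp (bhKStep d N (j + 1)) T t 0 g (Sum.inl 0)) = _
    refine tsum_sublattice₀ N _ _ (fun t ht => ?_) (fun q => ?_)
    · rw [Fintype.sum_sum_type]
      simp only [hM_inl, hM_inr, if_neg ht, mul_zero, Finset.sum_const_zero, zero_add]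
    · have hq : Torus.proj N ((N : ℤ) • q) = 0 := proj_zsmul q
      rw [Fintype.sum_sum_type]
      simp only [hM_inl, hM_inr, if_pos hq, quo_zsmul, mul_zero, Finset.sum_const_zero, zero_add, hc]
  -- evaluate the finitely supported coarse sum
  have hS : ∑' q : Fin (d + 1) → ℤ, ∑ m : Fin (d + 1), G u ((N : ℤ) • q) (Sum.inl κ') (Sum.inr m) *
        (stepScale d N (j + 1) * (c (q + AffineAveraging.unitVec m) - c q)) =
      (stepScale d N (j + 1) * (N : ℝ) ^ (d + 1)) * ∑ m, (colH G N m (y - B6BondElimination.unitVec m) κ' u - colH G N m y κ' u) := by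
    set S : Finset (Fin (d + 1) → ℤ) := insert y (Finset.univ.image fun m : Fin (d + 1) => y - AffineAveraging.unitVec m) with hSdef
    have hyS : y ∈ S := Finset.mem_insert_self _ _
    have hymS : ∀ m, y - AffineAveraging.unitVec m ∈ S := fun m =>
      Finset.mem_insert_of_mem (Finset.mem_image.2 ⟨m, Finset.mem_univ _, rfl⟩)
    rw [tsum_eq_sum (s := S)]
    · -- swap the two finite sums and evaluate the indicators
      rw [Finset.sum_comm, Finset.mul_sum]
      refine Finset.sum_congr rfl fun m _ => ?_
      have e1 : ∀ q, c (q + AffineAveraging.unitVec m) = if q = y - AffineAveraging.unitVec m then (N : ℝ) ^ (d + 1) else 0 := by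
        intro q
        simp only [hc]
        by_cases hq : q = y - AffineAveraging.unitVec m
        · rw [if_pos (by rw [hq]; abel), if_pos hq]
        · rw [if_neg (fun h => hq (by rw [← h]; abel)), if_neg hq]
      have e2 : ∀ q, G u ((N : ℤ) • q) (Sum.inl κ') (Sum.inr m) * (stepScale d N (j + 1) * (c (q + AffineAveraging.unitVec m) - c q)) =
          (if q = y - AffineAveraging.unitVec m then G u ((N : ℤ) • q) (Sum.inl κ') (Sum.inr m) * (stepScale d N (j + 1) * (N : ℝ) ^ (d + 1)) else 0) -
            (if q = y then G u ((N : ℤ) • q) (Sum.inl κ') (Sum.inr m) * (stepScale d N (j + 1) * (N : ℝ) ^ (d + 1)) else 0) := by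
        intro q
        rw [e1]
        simp only [hc]
        split_ifs <;> ring
      rw [Finset.sum_congr rfl (fun q _ => e2 q), Finset.sum_sub_distrib, Finset.sum_ite_eq' S (y - AffineAveraging.unitVec m),
        Finset.sum_ite_eq' S y, if_pos (hymS m), if_pos hyS]
      simp only [colH, b6UnitVec_eq]
      ring
    · intro q hq
      refine Finset.sum_eq_zero fun m _ => ?_
      have hqy : q ≠ y := fun h => hq (h ▸ hyS)
      have hqm : q + AffineAveraging.unitVec m ≠ y := by
        intro h
        apply hq
        have : q = y - AffineAveraging.unitVec m := by rw [← h]; abel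
        rw [this]; exact hymS m
      simp only [hc, if_neg hqy, if_neg hqm, sub_self, mul_zero]
  -- assemble
  rw [hL, hS, hR] at h2
  have hs0 : stepScale d N (j + 1) * (N : ℝ) ^ (d + 1) ≠ 0 := mul_ne_zero (stepScale_ne_zero (j + 1)) hN0
  rw [← h2, ← mul_assoc, inv_mul_cancel₀ hs0, one_mul]


/-! ## §2 (v1.1) All steps at once: the `cH`-family of the hW root -/

open Summit.QuantumFields.BalabanUV.Beta.KernelWardHColumn (colH_ward_of_AME) in
/-- [folklore] **THE ℋ-COLUMN WARD LAW AT EVERY STEP, ONE CONSTANT FAMILY** (v1.1): for a step family of spread kernels `G j`, each satisfying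
rule AME against the straight candidate `bhKStep d N j` (`= bhK N` at `j = 0`), the socket `hH` of
`KernelWardRelativeEnd.wardTransversal_flipK_TbalOf_JsBalBmNAtOf_ctrC(_parity)` holds for ALL `j` with
**`cH j := (stepScale d N j · N^{d+1})⁻¹`** (`stepScale d N 0 = 1`, so `cH 0 = N^{−(d+1)}`): `j = 0` by
`KernelWardHColumn.colH_ward_of_AME`, `j + 1` by `colH_ward_of_AME_step`. -/
theorem colH_ward_of_AME_all {Gs : ℕ → MKer (d + 1) (Fib d)} (hG : ∀ j, Spr (Gs j))
    (hAME : ∀ j, comp (comp (Gs j) (bhKStep d N j)) (axEc ρ N) = axEc ρ N) (j : ℕ) (y : Fin (d + 1) → ℤ) (κ' : Fin (d + 1))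
    (u : Fin (d + 1) → ℤ) :
    ∑ μ, (colH (Gs j) N μ (y - B6BondElimination.unitVec μ) κ' u - colH (Gs j) N μ y κ' u) =
      (stepScale d N j * (N : ℝ) ^ (d + 1))⁻¹ * gaugeWt N y κ' u := by
  cases j with
  | zero =>
    have h0 : stepScale d N 0 = 1 := by simp [stepScale]
    rw [h0, one_mul]
    exact colH_ward_of_AME (hG 0) (by simpa only [BorderedHessian.bhKStep_zero] using hAME 0) y κ' u
  | succ j => exact colH_ward_of_AME_step j (hG (j + 1)) (hAME (j + 1)) y κ' u

end Generic

end

end Summit.QuantumFields.BalabanUV.Beta.KernelWardHColumnStep
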